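import Mathlib.Analysis.SpecificLimits.Normed
import Summits.QuantumAdvantage.QuantumAdvantage.Theorems.CubicForrelationSignedCubicForrelationInPrBPPDefectDirectSum
import Literature.Computability.QuantumComplexity.ForrelationDirectSum
import Literature.Computability.QuantumComplexity.SignedCubicForrelation
import HarnessLib

/-!
# Item `CubicForrelation.SignedCubicForrelationInPrBPP` (stmt-QuantumAdvantage-13933) — `stub_structure` needs Dillon

Third of three support files (context in `…DefectIsotropic.lean`). The registered sufficient stub `stub_structure` of
the line `polar-radical-seeds` (every cubic pair on evenly many bits with `|Φ| ≥ 3/5` has a `⊕`-closed `V ∋ 0` with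
`2ⁿ ≤ |V|²(n+2)^{2c}` on whose cosets ONE of the two functions is affine) is shown to PRESUPPOSE the Dillon form of
the route's classification item r5 `ExactPairsMaioranaMcFarland`:

* `affine_on_cosets_directSum_of_factors` — the easy converse of sub-multiplicativity (products of M-subspaces are
  M-subspaces of the direct sum), so the M-defect is ADDITIVE under `⊕`;
* `exists_directPower` — direct powers of an exact cubic pair are exact cubic pairs (`forrelation_directSum`,
  `isDegLeFun_directSum`) whose M-subspaces are bounded by powers of the blocks' bounds
  (`exists_factors_of_affine_on_cosets_directSum`);
* `exists_power_beyond_log_defect` — ONE exact cubic pair `(f₀,g₀)` on `m+m` bits in which `g₀` has no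
  half-dimensional M-subspace yields, for EVERY `c`, an exact cubic pair on an even number `N` of bits with NO
  `V` of defect `≤ c log₂(N+2)` on either side (both defects of the `k`-fold power are `≥ k`, and
  `(Nk+2)^{2c} = o(4^k)`): such a pair refutes `stub_structure` and puts instances in the residue of `stub_residueR c`
  for every `c`;
* `exact_pair_halfdim_of_structure`, `exact_pair_halfdim_of_structure'` — hence `stub_structure` (signature verbatim)
  implies that in every exact cubic pair (`Φ = ±1`, `n` even) BOTH functions have a half-dimensional M-subspace, i.e.
  lie in the completed Maiorana–McFarland class by Dillon's criterion (Carlet 2021, Prop. 54).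

So the cheapest falsifier of the line's structural conjecture is the cheapest falsifier of r5: one cubic bent function
outside the completed MM class whose dual is cubic (none is known; Polujan–Pott 2020's non-MM# cubic bent functions in
10 variables have quartic duals).

References: C. Carlet, Boolean Functions for Cryptography and Coding Theory (CUP 2021), Prop. 54; J. F. Dillon,
Elementary Hadamard difference sets (1974); A. Polujan, A. Pott, Cubic bent functions outside the completed
Maiorana–McFarland class, Des. Codes Cryptogr. 88 (2020); S. Aaronson, A. Ambainis, Forrelation, SIAM J. Comput. 47
(2018), §1.1.1.
-/

noncomputable section

set_option linter.dupNamespace false -- D-0017: single-problem summit ⇒ `QuantumAdvantage.QuantumAdvantage` by design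

namespace Summit.QuantumAdvantage.QuantumAdvantage.Theorems.SignedCubicForrelationInPrBPP.DirectSumDefect

open Finset
open Literature.Computability.QuantumComplexity
open Literature.Computability.QuantumComplexity.BuzetChailloux (bxor zeroVec bxor_comm bxor_self bxor_zeroVec
  zeroVec_bxor bxor_bxor_cancel_left twist_bxor_right twist_zeroVec_right signOf_sq)
open Literature.Computability.QuantumComplexity.Simon (twist_sq twist_eq_one_or)
open Literature.Computability.QuantumComplexity.DerivativeWalsh (dual_affine_on_perp_cosets perp_perp_eq_of_sq
  bxor_mem_perp card_mul_card_perp abs_forrelation_mul_card_le_sqrt forrelation_not_right)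

/-! ### Products of M-subspaces (the M-defect is additive under `⊕`) -/

section DirectSumConverse

variable {N n₀ : ℕ}

/-- `⊕` of appended vectors is computed blockwise. -/
theorem bxor_append (a a' : Fin N → Bool) (b b' : Fin n₀ → Bool) :
    bxor (Fin.append a b) (Fin.append a' b') = Fin.append (bxor a a') (bxor b b') := by
  funext i
  refine Fin.addCases (fun i => ?_) (fun j => ?_) i <;> simp [bxor]

/-- Eight-variable `xor` bookkeeping, converse direction: two vanishing quads give a vanishing quad of pairs. -/
theorem xor_pairs_false_of_quads (a₁ a₂ a₃ a₄ b₁ b₂ b₃ b₄ : Bool)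
    (ha : (a₁ ^^ a₂ ^^ a₃ ^^ a₄) = false) (hb : (b₁ ^^ b₂ ^^ b₃ ^^ b₄) = false) :
    ((a₁ ^^ b₁) ^^ (a₂ ^^ b₂) ^^ (a₃ ^^ b₃) ^^ (a₄ ^^ b₄)) = false := by
  revert ha hb a₁ a₂ a₃ a₄ b₁ b₂ b₃ b₄; decide

/-- **Products of M-subspaces are M-subspaces of the direct sum** (the easy converse of
`exists_factors_of_affine_on_cosets_directSum`): together the two give that the M-defect is ADDITIVE under `⊕`. -/
theorem affine_on_cosets_directSum_of_factors (F : (Fin N → Bool) → Bool) (f₀ : (Fin n₀ → Bool) → Bool)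
    (V₁ : Finset (Fin N → Bool)) (V₂ : Finset (Fin n₀ → Bool)) (h10 : zeroVec ∈ V₁)
    (h1add : ∀ x ∈ V₁, ∀ y ∈ V₁, bxor x y ∈ V₁)
    (h1M : ∀ u ∈ V₁, ∀ v ∈ V₁, ∀ y, (F y ^^ F (bxor y u) ^^ F (bxor y v) ^^ F (bxor y (bxor u v))) = false)
    (h20 : zeroVec ∈ V₂) (h2add : ∀ x ∈ V₂, ∀ y ∈ V₂, bxor x y ∈ V₂)
    (h2M : ∀ u ∈ V₂, ∀ v ∈ V₂, ∀ y, (f₀ y ^^ f₀ (bxor y u) ^^ f₀ (bxor y v) ^^ f₀ (bxor y (bxor u v))) = false) :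
    ∃ V : Finset (Fin (N + n₀) → Bool), zeroVec ∈ V ∧ (∀ x ∈ V, ∀ y ∈ V, bxor x y ∈ V) ∧
      (∀ u ∈ V, ∀ v ∈ V, ∀ y : Fin (N + n₀) → Bool,
        ((xor (F fun i => y (Fin.castAdd n₀ i)) (f₀ fun j => y (Fin.natAdd N j))) ^^
          (xor (F fun i => (bxor y u) (Fin.castAdd n₀ i)) (f₀ fun j => (bxor y u) (Fin.natAdd N j))) ^^
          (xor (F fun i => (bxor y v) (Fin.castAdd n₀ i)) (f₀ fun j => (bxor y v) (Fin.natAdd N j))) ^^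
          (xor (F fun i => (bxor y (bxor u v)) (Fin.castAdd n₀ i))
            (f₀ fun j => (bxor y (bxor u v)) (Fin.natAdd N j)))) = false) ∧
      V.card = V₁.card * V₂.card := by
  have happ0 : (zeroVec : Fin (N + n₀) → Bool) = Fin.append zeroVec zeroVec := by
    funext i
    refine Fin.addCases (fun i => ?_) (fun j => ?_) i <;> simp [zeroVec]
  refine ⟨(V₁ ×ˢ V₂).image fun ab => Fin.append ab.1 ab.2, ?_, ?_, ?_, ?_⟩
  · exact mem_image.2 ⟨(zeroVec, zeroVec), mem_product.2 ⟨h10, h20⟩, happ0.symm⟩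
  · intro x hx y hy
    obtain ⟨⟨a, b⟩, hab, rfl⟩ := mem_image.1 hx
    obtain ⟨⟨a', b'⟩, hab', rfl⟩ := mem_image.1 hy
    obtain ⟨ha, hb⟩ := mem_product.1 hab
    obtain ⟨ha', hb'⟩ := mem_product.1 hab'
    exact mem_image.2 ⟨(bxor a a', bxor b b'), mem_product.2 ⟨h1add a ha a' ha', h2add b hb b' hb'⟩,
      (bxor_append a a' b b').symm⟩
  · intro u hu v hv y
    obtain ⟨⟨a, b⟩, hab, rfl⟩ := mem_image.1 hu
    obtain ⟨⟨a', b'⟩, hab', rfl⟩ := mem_image.1 hv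
    obtain ⟨ha, hb⟩ := mem_product.1 hab
    obtain ⟨ha', hb'⟩ := mem_product.1 hab'
    dsimp only
    rw [bxor_append]
    simp only [bxor, Fin.append_left, Fin.append_right]
    exact xor_pairs_false_of_quads _ _ _ _ _ _ _ _ (h1M a ha a' ha' fun i => y (Fin.castAdd n₀ i))
      (h2M b hb b' hb' fun j => y (Fin.natAdd N j))
  · rw [card_image_of_injOn, card_product]
    rintro ⟨a, b⟩ _ ⟨a', b'⟩ _ he
    simp only at he
    have h1 : a = a' := funext fun i => by simpa [Fin.append_left] using congrFun he (Fin.castAdd n₀ i)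
    have h2 : b = b' := funext fun j => by simpa [Fin.append_right] using congrFun he (Fin.natAdd N j)
    rw [h1, h2]

end DirectSumConverse

/-! ### Direct powers of an exact pair and the main theorem -/

section Power

variable {n₁ n₂ : ℕ}

/-- Degrees do not grow under direct sums (rename the variables of the two ANFs and add).
-- adapted from Cruxes/CubicForrelationInPrBPP/Disproof.lean (`isDegLeFun_dsum`) -/
theorem isDegLeFun_directSum {d : ℕ} {f₁ : (Fin n₁ → Bool) → Bool} {f₂ : (Fin n₂ → Bool) → Bool}
    (h₁ : IsDegLeFun d f₁) (h₂ : IsDegLeFun d f₂) :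
    IsDegLeFun d (fun x : Fin (n₁ + n₂) → Bool =>
      xor (f₁ fun i => x (Fin.castAdd n₂ i)) (f₂ fun j => x (Fin.natAdd n₁ j))) := by
  obtain ⟨p₁, hp₁, hf₁⟩ := h₁
  obtain ⟨p₂, hp₂, hf₂⟩ := h₂
  refine ⟨MvPolynomial.rename (Fin.castAdd n₂) p₁ + MvPolynomial.rename (Fin.natAdd n₁) p₂, ?_,
    fun x => ?_⟩
  · exact (MvPolynomial.totalDegree_add _ _).trans (max_le
      ((MvPolynomial.totalDegree_rename_le _ _).trans hp₁)
      ((MvPolynomial.totalDegree_rename_le _ _).trans hp₂))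
  · show xor (f₁ _) (f₂ _) = _
    rw [hf₁, hf₂]
    simp only [polyPhase, map_add, MvPolynomial.eval_rename, Function.comp_def]
    generalize MvPolynomial.eval _ p₁ = a
    generalize MvPolynomial.eval _ p₂ = b
    revert a b
    decide

/-- The empty pair is exact: `Φ = 1` on zero bits for the constant-`0` functions. -/
theorem forrelation_zero_bits : forrelation (n := 0) (fun _ => false) (fun _ => false) = 1 := by
  unfold forrelation
  simp [signOf, twist]

/-- **Direct powers of an exact cubic pair.** If `(f₀, g₀)` on `n₀` bits is cubic and exact and every
M-subspace of `f₀` (resp. `g₀`) has at most `A` (resp. `B`) elements, then for every `k` the `k`-fold direct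
power is a cubic exact pair on `n₀ k` bits all of whose M-subspaces have at most `A^k` (resp. `B^k`) elements. -/
theorem exists_directPower {n₀ : ℕ} (f₀ g₀ : (Fin n₀ → Bool) → Bool) (hf : IsDegLeFun 3 f₀)
    (hg : IsDegLeFun 3 g₀) (hΦ : forrelation f₀ g₀ = 1) (A B : ℕ)
    (hA : ∀ V : Finset (Fin n₀ → Bool), zeroVec ∈ V → (∀ x ∈ V, ∀ y ∈ V, bxor x y ∈ V) →
      (∀ u ∈ V, ∀ v ∈ V, ∀ y, (f₀ y ^^ f₀ (bxor y u) ^^ f₀ (bxor y v) ^^ f₀ (bxor y (bxor u v))) = false) →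
      V.card ≤ A)
    (hB : ∀ V : Finset (Fin n₀ → Bool), zeroVec ∈ V → (∀ x ∈ V, ∀ y ∈ V, bxor x y ∈ V) →
      (∀ u ∈ V, ∀ v ∈ V, ∀ y, (g₀ y ^^ g₀ (bxor y u) ^^ g₀ (bxor y v) ^^ g₀ (bxor y (bxor u v))) = false) →
      V.card ≤ B) :
    ∀ k : ℕ, ∃ N : ℕ, N = n₀ * k ∧ ∃ F G : (Fin N → Bool) → Bool, IsDegLeFun 3 F ∧ IsDegLeFun 3 G ∧
      forrelation F G = 1 ∧
      (∀ V : Finset (Fin N → Bool), zeroVec ∈ V → (∀ x ∈ V, ∀ y ∈ V, bxor x y ∈ V) →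
        (∀ u ∈ V, ∀ v ∈ V, ∀ y, (F y ^^ F (bxor y u) ^^ F (bxor y v) ^^ F (bxor y (bxor u v))) = false) →
        V.card ≤ A ^ k) ∧
      (∀ V : Finset (Fin N → Bool), zeroVec ∈ V → (∀ x ∈ V, ∀ y ∈ V, bxor x y ∈ V) →
        (∀ u ∈ V, ∀ v ∈ V, ∀ y, (G y ^^ G (bxor y u) ^^ G (bxor y v) ^^ G (bxor y (bxor u v))) = false) →
        V.card ≤ B ^ k) := by
  intro k
  induction k with
  | zero =>
    refine ⟨0, by simp, fun _ => false, fun _ => false, isDegLeFun_const 3 false, isDegLeFun_const 3 false,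
      forrelation_zero_bits, fun V _ _ _ => ?_, fun V _ _ _ => ?_⟩ <;>
    · rw [pow_zero]
      exact (card_le_univ V).trans (by simp)
  | succ k ih =>
    obtain ⟨N, hN, F, G, hF, hG, hFG, hAV, hBV⟩ := ih
    refine ⟨N + n₀, by rw [hN]; ring, _, _, isDegLeFun_directSum hF hf, isDegLeFun_directSum hG hg,
      by rw [forrelation_directSum, hFG, hΦ, mul_one], fun V h0 hadd hM => ?_, fun V h0 hadd hM => ?_⟩
    · obtain ⟨V₁, V₂, ⟨h10, h1add, h1M⟩, ⟨h20, h2add, h2M⟩, hcard⟩ :=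
        exists_factors_of_affine_on_cosets_directSum F f₀ V h0 hadd hM
      rw [pow_succ]
      exact hcard.trans (Nat.mul_le_mul (hAV V₁ h10 h1add h1M) (hA V₂ h20 h2add h2M))
    · obtain ⟨V₁, V₂, ⟨h10, h1add, h1M⟩, ⟨h20, h2add, h2M⟩, hcard⟩ :=
        exists_factors_of_affine_on_cosets_directSum G g₀ V h0 hadd hM
      rw [pow_succ]
      exact hcard.trans (Nat.mul_le_mul (hBV V₁ h10 h1add h1M) (hB V₂ h20 h2add h2M))

end Power

/-- **One non-Dillon exact cubic pair beats every logarithmic defect budget.** If `(f₀, g₀)` is an exact cubic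
pair on `m + m` bits and `g₀` has NO half-dimensional M-subspace, then for every `c` some direct power `(F, G)` of it
— an exact cubic pair on an even number `N` of bits — has NO `⊕`-closed `V ∋ 0` with `2^N ≤ |V|² (N+2)^{2c}` on whose
cosets `F` or `G` is affine: both M-defects of the `k`-fold power are `≥ k` (`exists_directPower` with
`card_MSubspace_le_of_no_halfdim`), and `4^k > (Nk… + 2)^{2c}` for large `k`. In the language of the line
`polar-radical-seeds`: one such pair makes the residue of `stub_residueR c` non-empty for EVERY `c` and refutes
`stub_structure`. -/
theorem exists_power_beyond_log_defect {m : ℕ} (f₀ g₀ : (Fin (m + m) → Bool) → Bool) (hf : IsDegLeFun 3 f₀)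
    (hg : IsDegLeFun 3 g₀) (hΦ : forrelation f₀ g₀ = 1)
    (hno : ¬ ∃ V : Finset (Fin (m + m) → Bool), zeroVec ∈ V ∧ (∀ x ∈ V, ∀ y ∈ V, bxor x y ∈ V) ∧
      (V.card : ℝ) ^ 2 = (2 : ℝ) ^ (m + m) ∧
      ∀ u ∈ V, ∀ v ∈ V, ∀ y, (g₀ y ^^ g₀ (bxor y u) ^^ g₀ (bxor y v) ^^ g₀ (bxor y (bxor u v))) = false)
    (c : ℕ) :
    ∃ N : ℕ, Even N ∧ ∃ F G : (Fin N → Bool) → Bool, IsDegLeFun 3 F ∧ IsDegLeFun 3 G ∧ forrelation F G = 1 ∧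
      ∀ V : Finset (Fin N → Bool), zeroVec ∈ V → (∀ x ∈ V, ∀ y ∈ V, bxor x y ∈ V) →
        ((∀ u ∈ V, ∀ v ∈ V, ∀ y, (F y ^^ F (bxor y u) ^^ F (bxor y v) ^^ F (bxor y (bxor u v))) = false) ∨
         (∀ u ∈ V, ∀ v ∈ V, ∀ y, (G y ^^ G (bxor y u) ^^ G (bxor y v) ^^ G (bxor y (bxor u v))) = false)) →
        V.card ^ 2 * (N + 2) ^ (2 * c) < 2 ^ N := by
  obtain ⟨hBg, hAf⟩ := card_MSubspace_le_of_no_halfdim f₀ g₀ hΦ hno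
  -- `m = 0` is impossible (the trivial subspace is half-dimensional), so write `m = m' + 1`
  obtain ⟨m', rfl⟩ : ∃ m', m = m' + 1 := by
    rcases Nat.eq_zero_or_pos m with h | h
    · subst h
      exfalso
      have := hBg {zeroVec} (mem_singleton_self _) (fun x hx y hy => by
        rw [mem_singleton] at hx hy ⊢; rw [hx, hy, bxor_self])
        (fun u hu v hv y => by
          rw [mem_singleton] at hu hv; rw [hu, hv, bxor_self, bxor_zeroVec]
          generalize g₀ y = p; revert p; decide)
      simp at this
    · exact ⟨m - 1, by omega⟩
  have hA : ∀ V : Finset (Fin (m' + 1 + (m' + 1)) → Bool), zeroVec ∈ V → (∀ x ∈ V, ∀ y ∈ V, bxor x y ∈ V) →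
      (∀ u ∈ V, ∀ v ∈ V, ∀ y,
        (f₀ y ^^ f₀ (bxor y u) ^^ f₀ (bxor y v) ^^ f₀ (bxor y (bxor u v))) = false) → V.card ≤ 2 ^ m' := by
    intro V h0 hadd hM
    have := hAf V h0 hadd hM
    rw [pow_succ] at this
    exact Nat.le_of_mul_le_mul_right this (by norm_num)
  have hB : ∀ V : Finset (Fin (m' + 1 + (m' + 1)) → Bool), zeroVec ∈ V → (∀ x ∈ V, ∀ y ∈ V, bxor x y ∈ V) →
      (∀ u ∈ V, ∀ v ∈ V, ∀ y,
        (g₀ y ^^ g₀ (bxor y u) ^^ g₀ (bxor y v) ^^ g₀ (bxor y (bxor u v))) = false) → V.card ≤ 2 ^ m' := by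
    intro V h0 hadd hM
    have := hBg V h0 hadd hM
    rw [pow_succ] at this
    exact Nat.le_of_mul_le_mul_right this (by norm_num)
  have hpow := exists_directPower f₀ g₀ hf hg hΦ (2 ^ m') (2 ^ m') hA hB
  -- choose `k ≥ 1` with `(a k)^(2c) < 4^k`, `a = n₀ + 2`
  set a : ℕ := m' + 1 + (m' + 1) + 2 with ha
  have hlim := tendsto_pow_const_div_const_pow_of_one_lt (2 * c) (by norm_num : (1 : ℝ) < 4)
  have hε : (0 : ℝ) < 1 / (a : ℝ) ^ (2 * c) := by positivity
  obtain ⟨k, hk, hk1⟩ := ((hlim.eventually (gt_mem_nhds hε)).and (Filter.eventually_ge_atTop 1)).exists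
  have hsmall : ((m' + 1 + (m' + 1)) * k + 2) ^ (2 * c) < 4 ^ k := by
    have hle : ((m' + 1 + (m' + 1)) * k + 2 : ℕ) ≤ a * k := by rw [ha]; nlinarith
    have hapos : (0 : ℝ) < (a : ℝ) ^ (2 * c) := by positivity
    have h4pos : (0 : ℝ) < (4 : ℝ) ^ k := by positivity
    rw [div_lt_iff₀ h4pos] at hk
    have h3 : ((a : ℝ) * k) ^ (2 * c) < (4 : ℝ) ^ k := by
      rw [mul_pow, ← lt_div_iff₀' hapos]
      calc (k : ℝ) ^ (2 * c) < 1 / (a : ℝ) ^ (2 * c) * (4 : ℝ) ^ k := hk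
        _ = (4 : ℝ) ^ k / (a : ℝ) ^ (2 * c) := by ring
    have h3' : (a * k) ^ (2 * c) < 4 ^ k := by exact_mod_cast h3
    exact lt_of_le_of_lt (Nat.pow_le_pow_left hle _) h3'
  obtain ⟨N, hN, F, G, hF, hG, hFG, hAV, hBV⟩ := hpow k
  have hNeven : Even N := by rw [hN]; exact Even.mul_right ⟨m' + 1, rfl⟩ k
  refine ⟨N, hNeven, F, G, hF, hG, hFG, fun V h0 hadd hM => ?_⟩
  have hVle : V.card ≤ (2 ^ m') ^ k := by
    rcases hM with hM | hM
    · exact hAV V h0 hadd hM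
    · exact hBV V h0 hadd hM
  have h2N : 2 ^ N = ((2 ^ m') ^ k) ^ 2 * 4 ^ k := by
    rw [hN, ← pow_mul, ← pow_mul, show (4 : ℕ) = 2 ^ 2 by norm_num, ← pow_mul, ← pow_add]
    congr 1; ring
  rw [← hN] at hsmall
  rw [h2N]
  calc V.card ^ 2 * (N + 2) ^ (2 * c)
      ≤ ((2 ^ m') ^ k) ^ 2 * (N + 2) ^ (2 * c) :=
        Nat.mul_le_mul_right _ (Nat.pow_le_pow_left hVle 2)
    _ < ((2 ^ m') ^ k) ^ 2 * 4 ^ k := Nat.mul_lt_mul_of_pos_left hsmall (by positivity)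

/-- **The structure statement presupposes Dillon's criterion on the exact slice.** If every cubic pair on evenly
many bits with `|Φ| ≥ 3/5` has a `⊕`-closed `V ∋ 0` of M-defect `≤ c log₂(n+2)` on whose cosets ONE of the two
functions is affine (`stub_structure` of the line `polar-radical-seeds`, registered signature verbatim), then in
every EXACT cubic pair (`Φ = 1`, `n` even) the second function has a HALF-DIMENSIONAL M-subspace (`|V|² = 2ⁿ`),
i.e. lies in the completed Maiorana–McFarland class by Dillon's criterion (Carlet 2020, Prop. 54): the structure
statement implies the Dillon form of the route's classification item `ExactPairsMaioranaMcFarland`, and ONE cubic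
bent function outside the completed MM class with a cubic dual refutes it (`exists_power_beyond_log_defect`). -/
theorem exact_pair_halfdim_of_structure
    (hS : ∃ c : ℕ, ∀ (n : ℕ), Even n → ∀ f g : (Fin n → Bool) → Bool,
      IsDegLeFun 3 f → IsDegLeFun 3 g → (3 / 5 : ℝ) ≤ |forrelation f g| →
      ∃ V : Finset (Fin n → Bool), zeroVec ∈ V ∧ (∀ x ∈ V, ∀ y ∈ V, bxor x y ∈ V) ∧
        2 ^ n ≤ V.card ^ 2 * (n + 2) ^ (2 * c) ∧
        ((∀ u ∈ V, ∀ v ∈ V, ∀ y, (f y ^^ f (bxor y u) ^^ f (bxor y v) ^^ f (bxor y (bxor u v))) = false) ∨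
         (∀ u ∈ V, ∀ v ∈ V, ∀ y, (g y ^^ g (bxor y u) ^^ g (bxor y v) ^^ g (bxor y (bxor u v))) = false)))
    {n₀ : ℕ} (hn₀ : Even n₀) (f₀ g₀ : (Fin n₀ → Bool) → Bool) (hf : IsDegLeFun 3 f₀) (hg : IsDegLeFun 3 g₀)
    (hΦ : forrelation f₀ g₀ = 1) :
    ∃ V : Finset (Fin n₀ → Bool), zeroVec ∈ V ∧ (∀ x ∈ V, ∀ y ∈ V, bxor x y ∈ V) ∧
      (V.card : ℝ) ^ 2 = (2 : ℝ) ^ n₀ ∧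
      ∀ u ∈ V, ∀ v ∈ V, ∀ y, (g₀ y ^^ g₀ (bxor y u) ^^ g₀ (bxor y v) ^^ g₀ (bxor y (bxor u v))) = false := by
  obtain ⟨c, hc⟩ := hS
  obtain ⟨m, rfl⟩ := hn₀
  by_contra hno
  obtain ⟨N, hNeven, F, G, hF, hG, hFG, hlt⟩ := exists_power_beyond_log_defect f₀ g₀ hf hg hΦ hno c
  obtain ⟨V, h0, hadd, hcard, hM⟩ := hc N hNeven F G hF hG (by rw [hFG]; norm_num)
  exact absurd hcard (not_le.2 (hlt V h0 hadd hM))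

/-- The same for the FIRST function of an exact pair (by symmetry of `Φ`), and for `Φ = -1` (complement `g`). -/
theorem exact_pair_halfdim_of_structure' 
    (hS : ∃ c : ℕ, ∀ (n : ℕ), Even n → ∀ f g : (Fin n → Bool) → Bool,
      IsDegLeFun 3 f → IsDegLeFun 3 g → (3 / 5 : ℝ) ≤ |forrelation f g| →
      ∃ V : Finset (Fin n → Bool), zeroVec ∈ V ∧ (∀ x ∈ V, ∀ y ∈ V, bxor x y ∈ V) ∧
        2 ^ n ≤ V.card ^ 2 * (n + 2) ^ (2 * c) ∧
        ((∀ u ∈ V, ∀ v ∈ V, ∀ y, (f y ^^ f (bxor y u) ^^ f (bxor y v) ^^ f (bxor y (bxor u v))) = false) ∨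
         (∀ u ∈ V, ∀ v ∈ V, ∀ y, (g y ^^ g (bxor y u) ^^ g (bxor y v) ^^ g (bxor y (bxor u v))) = false)))
    {n₀ : ℕ} (hn₀ : Even n₀) (f₀ g₀ : (Fin n₀ → Bool) → Bool) (hf : IsDegLeFun 3 f₀) (hg : IsDegLeFun 3 g₀)
    (hΦ : forrelation f₀ g₀ = 1 ∨ forrelation f₀ g₀ = -1) :
    (∃ V : Finset (Fin n₀ → Bool), zeroVec ∈ V ∧ (∀ x ∈ V, ∀ y ∈ V, bxor x y ∈ V) ∧
      (V.card : ℝ) ^ 2 = (2 : ℝ) ^ n₀ ∧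
      ∀ u ∈ V, ∀ v ∈ V, ∀ y, (f₀ y ^^ f₀ (bxor y u) ^^ f₀ (bxor y v) ^^ f₀ (bxor y (bxor u v))) = false) ∧
    (∃ V : Finset (Fin n₀ → Bool), zeroVec ∈ V ∧ (∀ x ∈ V, ∀ y ∈ V, bxor x y ∈ V) ∧
      (V.card : ℝ) ^ 2 = (2 : ℝ) ^ n₀ ∧
      ∀ u ∈ V, ∀ v ∈ V, ∀ y, (g₀ y ^^ g₀ (bxor y u) ^^ g₀ (bxor y v) ^^ g₀ (bxor y (bxor u v))) = false) := by
  -- reduce `Φ = -1` to `Φ = 1` by complementing `g₀`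
  have key : ∀ g : (Fin n₀ → Bool) → Bool, IsDegLeFun 3 g → forrelation f₀ g = 1 →
      (∃ V : Finset (Fin n₀ → Bool), zeroVec ∈ V ∧ (∀ x ∈ V, ∀ y ∈ V, bxor x y ∈ V) ∧
        (V.card : ℝ) ^ 2 = (2 : ℝ) ^ n₀ ∧
        ∀ u ∈ V, ∀ v ∈ V, ∀ y, (f₀ y ^^ f₀ (bxor y u) ^^ f₀ (bxor y v) ^^ f₀ (bxor y (bxor u v))) = false) ∧
      (∃ V : Finset (Fin n₀ → Bool), zeroVec ∈ V ∧ (∀ x ∈ V, ∀ y ∈ V, bxor x y ∈ V) ∧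
        (V.card : ℝ) ^ 2 = (2 : ℝ) ^ n₀ ∧
        ∀ u ∈ V, ∀ v ∈ V, ∀ y, (g y ^^ g (bxor y u) ^^ g (bxor y v) ^^ g (bxor y (bxor u v))) = false) := by
    intro g hg' h1
    have h1' : forrelation g f₀ = 1 := by rw [forrelation_symm]; exact h1
    exact ⟨exact_pair_halfdim_of_structure hS hn₀ g f₀ hg' hf h1',
      exact_pair_halfdim_of_structure hS hn₀ f₀ g hf hg' h1⟩
  rcases hΦ with h | h
  · exact key g₀ hg h
  · have hneg : forrelation f₀ (fun y => !g₀ y) = 1 := by rw [forrelation_not_right, h]; norm_num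
    obtain ⟨hF, V, h0, hadd, hcard, hM⟩ := key _ hg.not hneg
    refine ⟨hF, V, h0, hadd, hcard, fun u hu v hv y => ?_⟩
    rw [← sd_not]; exact hM u hu v hv y

end Summit.QuantumAdvantage.QuantumAdvantage.Theorems.SignedCubicForrelationInPrBPP.DirectSumDefect

end
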